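import Mathlib
import HarnessLib
import Summits.Ventures.LatticeQCDFlow.Exactness.NCMCGeneralSpaceRestartChainVarianceDichotomy
import Summits.Ventures.LatticeQCDFlow.Exactness.NCMCGeneralSpaceParallelChainAutocov
import Summits.Ventures.LatticeQCDFlow.Exactness.NCMCGeneralSpaceRestartChainReweightedCLT

/-!
# The variance hypotheses of the BAR and reweighting lanes along correlated launches are never an extra assumption: `σ²_pair ≥ (e₀/(2e₀+4)) Var_F σ(ΔF−W) + (e₁/(2e₁+4)) Var_R σ(W−ΔF)` and `0 < σ²_c ↔ 0 < Var_F c`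

HONEST FRAMING: exact (Metropolis-corrected) sampling algorithms for lattice gauge theory;
figures of merit are autocorrelation/cost numbers at stated couplings and volumes; no
continuum-physics claim.

Venture `LatticeQCDFlow` (cell pub-lqcd), topic `Exactness`; FANOUT row 13 (`eng-snf`, GEN-23).
NEW WORK of the cell, not a published result; no definition is introduced; nothing is cited as a
fact.  GEN-23's `NCMCGeneralSpaceRestartChainVarianceDichotomy` showed that along the restart chain
EVERY bounded record observable has `σ²_g ≥ (e/(2e+4)) Var_F g` (GEN-20's one-step floor through
GEN-18's minorisation), closing the Jarzynski lane's `σ²_w > 0` hypothesis.  THIS file does the same for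
the two other lanes GEN-22 typed along correlated launches: the BAR pair variance
`σ²_pair = σ²_fwd + σ²_rev` (`NCMCGeneralSpaceParallelChainAutocov.CrooksPair.barPairVariance_eq_add`)
is bounded below leg by leg — the reverse leg is the restart chain `(κR ∘ₖ K₁).comap e` of the
REVERSE stream, one-step minorised by `m₁(Ω) · m̄₁` (`measure_le_comp_comap`) and stationary under
`P_R` (`invariant_restartKernel_rev`) — so `σ²_pair > 0` as soon as EITHER Fermi-weight series is
non-degenerate; and the reweighting lane's `σ²_c` (`c = e^{−W}(f∘e − μ_f)`, GEN-22
`NCMCGeneralSpaceRestartChainReweightedCLT`) obeys the dichotomy `0 < σ²_c ↔ 0 < Var_F c`.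

## Content (Crooks pair, `Z₀ ≠ 0 ≠ Z₁`; `K₀`, `K₁` Markov, `ν₀`- resp. `ν₁`-invariant, `m₀ ≤ K₀(z,·)`,
## `m₁ ≤ K₁(z,·)`, `e_j = m_j(Ω).toReal > 0`)

* **`CrooksPair.variance_le_greenKubo_variance_restartChain_rev`** — the reverse leg:
  `(e₁/(2e₁+4)) Var_R g ≤ σ²_g[R_rev]` for every bounded record observable `g`.
* **`CrooksPair.barPairVariance_ge`** — `σ²_pair ≥ (e₀/(2e₀+4)) Var_F σ(ΔF−W) + (e₁/(2e₁+4)) Var_R σ(W−ΔF)`;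
  **`CrooksPair.barPairVariance_pos_of_variance_pos`** — `σ²_pair > 0` if either variance is positive.
* **`CrooksPair.reweightVariance_pos_iff`** — `0 < σ²_c ↔ 0 < ∫ c² dP_F` (`E_F c = 0`), `−B ≤ W`,
  `|f| ≤ C_f`.

NOT CLAIMED: sharp constants; unbounded work or `f`; anything numerical.
-/

namespace Summit.Ventures.LatticeQCDFlow.Exactness.GeneralNCMC

open MeasureTheory ProbabilityTheory Set Filter Finset
open scoped ENNReal NNReal Topology

variable {Ω E : Type*} [MeasurableSpace Ω] [MeasurableSpace E]

namespace CrooksPair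

variable {ν₀ ν₁ : Measure Ω} [IsFiniteMeasure ν₀] [IsFiniteMeasure ν₁] {κF κR : Kernel Ω E}
  [IsMarkovKernel κF] [IsMarkovKernel κR] {s e : E → Ω} {W : E → ℝ}

/-! ## §1 The reverse leg -/

omit [IsFiniteMeasure ν₀] [IsMarkovKernel κF] in
/-- **`(e₁/(2e₁ + 4)) Var_R g ≤ σ²_g` ALONG THE REVERSE RESTART CHAIN**, every bounded measurable record
observable: `K₁` Markov, `ν₁`-invariant, `m₁ ≤ K₁(z, ·)` for all `z` (`m₁` finite, `m₁(Ω) ≠ 0`),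
`Z₁ ≠ 0`. -/
theorem variance_le_greenKubo_variance_restartChain_rev (K₁ : Kernel Ω Ω) [IsMarkovKernel K₁]
    (h1 : ν₁ univ ≠ 0) (hK₁ : Kernel.Invariant K₁ ν₁) (h : CrooksPair ν₀ ν₁ κF κR s e W)
    {m₁ : Measure Ω} [IsFiniteMeasure m₁] (hm₁ : m₁ univ ≠ 0) (hmin₁ : ∀ z, m₁ ≤ K₁ z)
    {g : E → ℝ} (hg : Measurable g) {C : ℝ} (hC : ∀ ω, |g ω| ≤ C) :
    (m₁ univ).toReal / (2 * (m₁ univ).toReal + 4)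
        * ∫ ω, (g ω - ∫ z, g z ∂(fwdPathLaw ν₁ κR)) ^ 2 ∂(fwdPathLaw ν₁ κR)
      ≤ Scoring.autocov ((κR ∘ₖ K₁).comap e h.measurable_e) (fwdPathLaw ν₁ κR)
          (fun ω => g ω - ∫ z, g z ∂(fwdPathLaw ν₁ κR)) 0
        + 2 * ∑' t, Scoring.autocov ((κR ∘ₖ K₁).comap e h.measurable_e) (fwdPathLaw ν₁ κR)
          (fun ω => g ω - ∫ z, g z ∂(fwdPathLaw ν₁ κR)) (t + 1) := by
  haveI := isProbabilityMeasure_fwdPathLaw ν₁ h1 κR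
  haveI := isProbabilityMeasure_normalised_bind_kernel κR hm₁
  have hmin1 : ∀ ω, m₁ univ • ((m₁ univ)⁻¹ • m₁.bind κR) ≤ ((κR ∘ₖ K₁).comap e h.measurable_e) ω :=
    fun ω => by
      rw [smul_smul, ENNReal.mul_inv_cancel hm₁ (measure_ne_top _ _), one_smul]
      exact measure_le_comp_comap K₁ κR h.measurable_e hmin₁ ω
  exact greenKubo_variance_ge_of_minorised (invariant_restartKernel_rev K₁ hK₁ h) hm₁ hmin1 hg hC

/-! ## §2 The BAR lane: `σ²_pair` is bounded below leg by leg -/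

/-- **`σ²_pair ≥ (e₀/(2e₀+4)) Var_F σ(ΔF − W) + (e₁/(2e₁+4)) Var_R σ(W − ΔF)`** along the two independent
restart chains of the BAR lane. -/
theorem barPairVariance_ge (K₀ K₁ : Kernel Ω Ω) [IsMarkovKernel K₀] [IsMarkovKernel K₁]
    (h0 : ν₀ univ ≠ 0) (h1 : ν₁ univ ≠ 0) (hK₀ : Kernel.Invariant K₀ ν₀)
    (hK₁ : Kernel.Invariant K₁ ν₁) (h : CrooksPair ν₀ ν₁ κF κR s e W) {ΔF : ℝ}
    (hΔF : Real.exp (-ΔF) = ((ν₀ univ)⁻¹ * ν₁ univ).toReal)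
    {m₀ m₁ : Measure Ω} [IsFiniteMeasure m₀] [IsFiniteMeasure m₁] (hm₀ : m₀ univ ≠ 0)
    (hm₁ : m₁ univ ≠ 0) (hmin₀ : ∀ z, m₀ ≤ K₀ z) (hmin₁ : ∀ z, m₁ ≤ K₁ z) :
    (m₀ univ).toReal / (2 * (m₀ univ).toReal + 4)
        * ∫ ω, (Real.sigmoid (ΔF - W ω) - ∫ z, Real.sigmoid (ΔF - W z) ∂(fwdPathLaw ν₀ κF)) ^ 2
          ∂(fwdPathLaw ν₀ κF)
      + (m₁ univ).toReal / (2 * (m₁ univ).toReal + 4)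
        * ∫ ω, (Real.sigmoid (W ω - ΔF) - ∫ z, Real.sigmoid (W z - ΔF) ∂(fwdPathLaw ν₁ κR)) ^ 2
          ∂(fwdPathLaw ν₁ κR)
      ≤ Scoring.autocov (((κF ∘ₖ K₀).comap s h.measurable_s) ∥ₖ ((κR ∘ₖ K₁).comap e h.measurable_e))
          ((fwdPathLaw ν₀ κF).prod (fwdPathLaw ν₁ κR))
          (fun p : E × E => Real.sigmoid (ΔF - W p.1) - Real.sigmoid (W p.2 - ΔF)) 0
        + 2 * ∑' t, Scoring.autocov
            (((κF ∘ₖ K₀).comap s h.measurable_s) ∥ₖ ((κR ∘ₖ K₁).comap e h.measurable_e))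
            ((fwdPathLaw ν₀ κF).prod (fwdPathLaw ν₁ κR))
            (fun p : E × E => Real.sigmoid (ΔF - W p.1) - Real.sigmoid (W p.2 - ΔF)) (t + 1) := by
  rw [h.barPairVariance_eq_add K₀ K₁ h0 h1 hK₀ hK₁ hΔF hm₀ hm₁ hmin₀ hmin₁]
  have hbF : ∀ ω, |Real.sigmoid (ΔF - W ω)| ≤ 1 := fun ω => by
    rw [abs_of_pos (Real.sigmoid_pos _)]; exact (Real.sigmoid_lt_one _).le
  have hbR : ∀ ω, |Real.sigmoid (W ω - ΔF)| ≤ 1 := fun ω => by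
    rw [abs_of_pos (Real.sigmoid_pos _)]; exact (Real.sigmoid_lt_one _).le
  have hmF : Measurable fun ω => Real.sigmoid (ΔF - W ω) :=
    _root_.continuous_sigmoid.measurable.comp (measurable_const.sub h.measurable_W)
  have hmR : Measurable fun ω => Real.sigmoid (W ω - ΔF) :=
    _root_.continuous_sigmoid.measurable.comp (h.measurable_W.sub measurable_const)
  exact add_le_add (h.variance_le_greenKubo_variance_restartChain K₀ h0 hK₀ hm₀ hmin₀ hmF hbF)
    (h.variance_le_greenKubo_variance_restartChain_rev K₁ h1 hK₁ hm₁ hmin₁ hmR hbR)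

/-- **`σ²_pair > 0` AS SOON AS EITHER FERMI-WEIGHT SERIES IS NON-DEGENERATE** (`Var_F σ(ΔF − W) > 0` or
`Var_R σ(W − ΔF) > 0`). -/
theorem barPairVariance_pos_of_variance_pos (K₀ K₁ : Kernel Ω Ω) [IsMarkovKernel K₀]
    [IsMarkovKernel K₁] (h0 : ν₀ univ ≠ 0) (h1 : ν₁ univ ≠ 0) (hK₀ : Kernel.Invariant K₀ ν₀)
    (hK₁ : Kernel.Invariant K₁ ν₁) (h : CrooksPair ν₀ ν₁ κF κR s e W) {ΔF : ℝ}
    (hΔF : Real.exp (-ΔF) = ((ν₀ univ)⁻¹ * ν₁ univ).toReal)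
    {m₀ m₁ : Measure Ω} [IsFiniteMeasure m₀] [IsFiniteMeasure m₁] (hm₀ : m₀ univ ≠ 0)
    (hm₁ : m₁ univ ≠ 0) (hmin₀ : ∀ z, m₀ ≤ K₀ z) (hmin₁ : ∀ z, m₁ ≤ K₁ z)
    (hV : 0 < ∫ ω, (Real.sigmoid (ΔF - W ω) - ∫ z, Real.sigmoid (ΔF - W z) ∂(fwdPathLaw ν₀ κF)) ^ 2
          ∂(fwdPathLaw ν₀ κF)
      ∨ 0 < ∫ ω, (Real.sigmoid (W ω - ΔF) - ∫ z, Real.sigmoid (W z - ΔF) ∂(fwdPathLaw ν₁ κR)) ^ 2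
          ∂(fwdPathLaw ν₁ κR)) :
    0 < Scoring.autocov (((κF ∘ₖ K₀).comap s h.measurable_s) ∥ₖ ((κR ∘ₖ K₁).comap e h.measurable_e))
          ((fwdPathLaw ν₀ κF).prod (fwdPathLaw ν₁ κR))
          (fun p : E × E => Real.sigmoid (ΔF - W p.1) - Real.sigmoid (W p.2 - ΔF)) 0
        + 2 * ∑' t, Scoring.autocov
            (((κF ∘ₖ K₀).comap s h.measurable_s) ∥ₖ ((κR ∘ₖ K₁).comap e h.measurable_e))
            ((fwdPathLaw ν₀ κF).prod (fwdPathLaw ν₁ κR))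
            (fun p : E × E => Real.sigmoid (ΔF - W p.1) - Real.sigmoid (W p.2 - ΔF)) (t + 1) := by
  have hfloor := h.barPairVariance_ge K₀ K₁ h0 h1 hK₀ hK₁ hΔF hm₀ hm₁ hmin₀ hmin₁
  have he : ∀ {m : Measure Ω} [IsFiniteMeasure m], m univ ≠ 0 →
      0 < (m univ).toReal / (2 * (m univ).toReal + 4) := by
    intro m _ hm
    have : 0 < (m univ).toReal := ENNReal.toReal_pos hm (measure_ne_top _ _)
    positivity
  have hVF : 0 ≤ ∫ ω, (Real.sigmoid (ΔF - W ω) - ∫ z, Real.sigmoid (ΔF - W z) ∂(fwdPathLaw ν₀ κF)) ^ 2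
      ∂(fwdPathLaw ν₀ κF) := integral_nonneg fun ω => sq_nonneg _
  have hVR : 0 ≤ ∫ ω, (Real.sigmoid (W ω - ΔF) - ∫ z, Real.sigmoid (W z - ΔF) ∂(fwdPathLaw ν₁ κR)) ^ 2
      ∂(fwdPathLaw ν₁ κR) := integral_nonneg fun ω => sq_nonneg _
  refine lt_of_lt_of_le ?_ hfloor
  rcases hV with hV | hV
  · exact add_pos_of_pos_of_nonneg (mul_pos (he hm₀) hV) (mul_nonneg (he hm₁).le hVR)
  · exact add_pos_of_nonneg_of_pos (mul_nonneg (he hm₀).le hVF) (mul_pos (he hm₁) hV)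

/-! ## §3 The reweighting lane: `0 < σ²_c ↔ 0 < Var_F c` -/

omit [IsMarkovKernel κR] in
/-- **THE REWEIGHTING LANE'S VARIANCE DICHOTOMY**: with `c = e^{−W}(f∘e − μ_f)`, `μ_f = Z₁⁻¹∫ f dν₁`,
`−B ≤ W`, `|f| ≤ C_f`: `0 < σ²_c ↔ 0 < ∫ (c − E_F c)² dP_F` along the restart chain. -/
theorem reweightVariance_pos_iff (K : Kernel Ω Ω) [IsMarkovKernel K] (h0 : ν₀ univ ≠ 0)
    (hK : Kernel.Invariant K ν₀) (h : CrooksPair ν₀ ν₁ κF κR s e W) {m : Measure Ω}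
    [IsFiniteMeasure m] (hm0 : m univ ≠ 0) (hmin : ∀ z, m ≤ K z) {B : ℝ} (hB : ∀ ω, -B ≤ W ω)
    {f : Ω → ℝ} (hfm : Measurable f) {Cf : ℝ} (hCf : ∀ y, |f y| ≤ Cf) :
    0 < Scoring.autocov ((κF ∘ₖ K).comap s h.measurable_s) (fwdPathLaw ν₀ κF)
          (fun ω => Real.exp (-W ω) * (f (e ω) - ((ν₁ univ)⁻¹).toReal * ∫ y, f y ∂ν₁)
            - ∫ z, Real.exp (-W z) * (f (e z) - ((ν₁ univ)⁻¹).toReal * ∫ y, f y ∂ν₁)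
              ∂(fwdPathLaw ν₀ κF)) 0
        + 2 * ∑' t, Scoring.autocov ((κF ∘ₖ K).comap s h.measurable_s) (fwdPathLaw ν₀ κF)
          (fun ω => Real.exp (-W ω) * (f (e ω) - ((ν₁ univ)⁻¹).toReal * ∫ y, f y ∂ν₁)
            - ∫ z, Real.exp (-W z) * (f (e z) - ((ν₁ univ)⁻¹).toReal * ∫ y, f y ∂ν₁)
              ∂(fwdPathLaw ν₀ κF)) (t + 1)
      ↔ 0 < ∫ ω, (Real.exp (-W ω) * (f (e ω) - ((ν₁ univ)⁻¹).toReal * ∫ y, f y ∂ν₁)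
          - ∫ z, Real.exp (-W z) * (f (e z) - ((ν₁ univ)⁻¹).toReal * ∫ y, f y ∂ν₁)
            ∂(fwdPathLaw ν₀ κF)) ^ 2 ∂(fwdPathLaw ν₀ κF) := by
  haveI := isProbabilityMeasure_fwdPathLaw ν₀ h0 κF
  have hCf0 : 0 ≤ Cf := (abs_nonneg _).trans (hCf (s (Classical.choice
    (nonempty_of_isProbabilityMeasure (fwdPathLaw ν₀ κF)))))
  set μf : ℝ := ((ν₁ univ)⁻¹).toReal * ∫ y, f y ∂ν₁ with hμf
  have hμfb : |μf| ≤ Cf := by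
    rw [hμf, abs_mul, ENNReal.toReal_inv, abs_inv, abs_of_nonneg ENNReal.toReal_nonneg]
    rcases eq_or_ne (ν₁ univ).toReal 0 with hz | hz
    · rw [hz, inv_zero, zero_mul]; exact hCf0
    · rw [inv_mul_le_iff₀ (lt_of_le_of_ne ENNReal.toReal_nonneg (Ne.symm hz)), ← Real.norm_eq_abs]
      calc ‖∫ y, f y ∂ν₁‖ ≤ Cf * ν₁.real univ :=
            norm_integral_le_of_norm_le_const (Eventually.of_forall fun y => by
              rw [Real.norm_eq_abs]; exact hCf y)
        _ = (ν₁ univ).toReal * Cf := by rw [measureReal_def, mul_comm]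
  have hcm : Measurable fun ω => Real.exp (-W ω) * (f (e ω) - μf) :=
    (Real.measurable_exp.comp h.measurable_W.neg).mul ((hfm.comp h.measurable_e).sub measurable_const)
  have hcb : ∀ ω, |Real.exp (-W ω) * (f (e ω) - μf)| ≤ Real.exp B * (2 * Cf) := fun ω => by
    rw [abs_mul, abs_of_pos (Real.exp_pos _)]
    refine mul_le_mul (Real.exp_le_exp.2 (by linarith [hB ω])) ?_ (abs_nonneg _) (Real.exp_pos _).le
    calc |f (e ω) - μf| ≤ |f (e ω)| + |μf| := abs_sub _ _
      _ ≤ Cf + Cf := add_le_add (hCf _) hμfb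
      _ = 2 * Cf := by ring
  exact h.greenKubo_variance_restartChain_pos_iff K h0 hK hm0 hmin hcm hcb

end CrooksPair

end Summit.Ventures.LatticeQCDFlow.Exactness.GeneralNCMC
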